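import Literature.AlgebraicGeometry.HodgeTheory.ComplexTorusIntegralHodgeClassesKunnethProjectors
import Literature.AlgebraicGeometry.HodgeTheory.ComplexTorusIntegralHodgeClassesCorrespondenceExteriorProduct
import HarnessLib

/-!
# The bigraded projectors `π_{s,X} × π_{t,X′}` act on exterior products of integral Hodge classes as the bidegree projectors

Sequel of g29-#4 (`ComplexTorusIntegralHodgeClassesCorrespondenceExteriorProduct`: `(α × β)_*(x ⊠ y) = α_*x ⊠ β_*y`, `(α × β)^*(u ⊠ v) = α^*u ⊠ β^*v`) and g29-#5
(`…KunnethProjectors` §4: `(π_s)_*` is the projector of `Hdg•(X, ℤ)` onto degree `s`, `π_s^*` the projector onto degree `2g − s` — Voisin's "`Id_k`"). For complex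
tori `X`, `X′` the `(s, t)`-pieces `π_{s,X} × π_{t,X′} ∈ Hdg^{g_X+g_{X′}}((X × X′) × (X × X′), ℤ)` of g29-#11/g30-#3 act on the exterior products `x ⊠ y` (`x ∈ Hdgᵖ(X,
ℤ)`, `y ∈ Hdg^{p′}(X′, ℤ)`) as the projectors onto the bidegree `(deg x, deg y) = (s, t)`:

* §1 **`integralHodgeClassesKunnethProjectorCross_pushforward_act`** — **`(π_{s,X} × π_{t,X′})_*(x ⊠ y) = δ_{2p,s} δ_{2p′,t} · (x ⊠ y)`** (Def. 16.1.2 `α_*(x) = p_{2*}(α ·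
  p₁^*x)`);
* §2 **`integralHodgeClassesKunnethProjectorCross_pushforward_coact`** — **`(π_{s,X} × π_{t,X′})^*(u ⊠ v) = δ_{s+2p,2g_X} δ_{t+2p′,2g_{X′}} · (u ⊠ v)`** (`α^*(u) = p_{1*}(α · p₂^*u)`).

Everything is a theorem; no definition, no named fact (D-0026). Frames: `eX`, `eXX`, `eX′`, `eX′X′` (Künneth projectors, g29-#5) and arbitrary frames `eP` of `(X × X′) ×
(X × X′)`, `eQ` of `X × X′` with their ranks `hnP`, `hnQ`.

## References
* [Fulton1998] W. Fulton, Intersection Theory, 2nd ed., Springer 1998, §16.1 Def. 16.1.2 (p0295 L9–L17), Example 16.1.12 (p0300 L9–L12, p0301 L9).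
* [VoisinHodgeI2002] C. Voisin, Hodge Theory and Complex Algebraic Geometry I, CUP 2002, §11.3.3 Thm. 11.38, p. 287.
* [Lange2023AbelianVarietiesComplex] H. Lange, Abelian Varieties over the Complex Numbers, Springer 2023, §6.3.3 Prop. 6.3.8 (p0317 L17), §6.3.4 (p0317 L28–L32).
-/

noncomputable section

open CategoryTheory Function

namespace Literature.AlgebraicGeometry.HodgeTheory

open Literature.AlgebraicGeometry.Motives Literature.AlgebraicGeometry.Motives.HodgeStructure
open Literature.Geometry.Kaehler Literature.Geometry.Kaehler.ComplexTorus

namespace ComplexTorusCat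

section Actions

variable (X X' : ComplexTorusCat) {gX gX' gXX gX'X' G nP nQ GP GQ : ℕ} (hG : gX + gX' = G)
  (eX : Fin (2 * gX) ≃ X.toIsog.ι) (eXX : Fin (2 * gXX) ≃ (prodObj X X).toIsog.ι)
  (hX0 : 2 * gX + 2 * 0 = 2 * gX) (hgX : gX + gX = 2 * gX) (hcX : 2 * gX + 2 * gX = 2 * gXX) (hgXX : gXX + gXX = 2 * gXX)
  (eX' : Fin (2 * gX') ≃ X'.toIsog.ι) (eX'X' : Fin (2 * gX'X') ≃ (prodObj X' X').toIsog.ι)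
  (hX'0 : 2 * gX' + 2 * 0 = 2 * gX') (hgX' : gX' + gX' = 2 * gX') (hcX' : 2 * gX' + 2 * gX' = 2 * gX'X') (hgX'X' : gX'X' + gX'X' = 2 * gX'X')
  (eP : Fin nP ≃ (prodObj (prodObj X X') (prodObj X X')).toIsog.ι) (eQ : Fin nQ ≃ (prodObj X X').toIsog.ι) (hnP : nP = 2 * gXX + 2 * gX'X')
  (hnQ : nQ = 2 * gX + 2 * gX') (hGP : GP + GP = nP) (hGQ : GQ + GQ = nQ)
  {p p' Q C q₁ q₁' lX lZ L : ℕ} (hpp' : p + p' = Q) (hGC : G + Q = C) (hq₁ : gX + p = q₁) (hq₁' : gX' + p' = q₁') (hqq : q₁ + q₁' = C)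
  (hs : lX + 2 * q₁ = 2 * gXX) (hr : lX + 2 * p = 2 * gX) (hs' : lZ + 2 * q₁' = 2 * gX'X') (hr' : lZ + 2 * p' = 2 * gX') (hC : L + 2 * C = nP) (hR : L + 2 * Q = nQ)

/-! ### §1 `(π_{s,X} × π_{t,X′})_*(x ⊠ y) = δ_{2p,s} δ_{2p′,t} · (x ⊠ y)` -/

include eX eX' hnP hnQ hgX hgXX hgX' hgX'X' hq₁ hq₁' hqq hs hr hs' hr' in
/-- **`(π_{s,X} × π_{t,X′})_*(x ⊠ y) = δ_{2p,s} δ_{2p′,t} · (x ⊠ y)`** for `x ∈ Hdgᵖ(X, ℤ)`, `y ∈ Hdg^{p′}(X′, ℤ)`: Fulton's action `α_*(z) = p_{2*}(α · p₁^* z)` of the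
`(s, t)`-piece `π_{s,X} × π_{t,X′}` of `Hdg((X × X′) × (X × X′), ℤ)` on an exterior product keeps it when `(deg x, deg y) = (s, t)` and kills it otherwise — `(α × β)_*(x ⊠ y) =
α_*x ⊠ β_*y` (g29-#4) and `(π_s)_*x = δ_{2p,s} x` (g29-#5 §4, Voisin's `Id_k`). [cite: Fulton1998, §16.1 Def. 16.1.2 (p0295 L9–L13) and Example 16.1.12 (p0301 L9)]
[cite: VoisinHodgeI2002, §11.3.3 p. 287] [cite: Lange2023AbelianVarietiesComplex, §6.3.4 (p0317 L28–L32)] -/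
theorem integralHodgeClassesKunnethProjectorCross_pushforward_act (s t : ℕ) (x : integralHodgeClasses X.toIsog.Φ p) (y : integralHodgeClasses X'.toIsog.Φ p') :
    integralHodgeClassesPushforward C Q (sndHom (prodObj X X') (prodObj X X')) eP eQ hC hGP hR hGQ
        (integralHodgeClassesCup (prodObj (prodObj X X') (prodObj X X')).toIsog.Φ hGC
          (integralHodgeClassesCup (prodObj (prodObj X X') (prodObj X X')).toIsog.Φ hG
            (integralHodgeClassesPullbackHom
              (liftHom (fstHom (prodObj X X') (prodObj X X') ≫ fstHom X X') (sndHom (prodObj X X') (prodObj X X') ≫ fstHom X X')) gX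
              (kunnethProjector X eX eXX hX0 hgX hcX hgXX s))
            (integralHodgeClassesPullbackHom
              (liftHom (fstHom (prodObj X X') (prodObj X X') ≫ sndHom X X') (sndHom (prodObj X X') (prodObj X X') ≫ sndHom X X')) gX'
              (kunnethProjector X' eX' eX'X' hX'0 hgX' hcX' hgX'X' t)))
          (integralHodgeClassesPullbackHom (fstHom (prodObj X X') (prodObj X X')) Q (integralHodgeClassesCross X X' hpp' x y))) =
      if 2 * p = s ∧ 2 * p' = t then integralHodgeClassesCross X X' hpp' x y else 0 := by
  rw [integralHodgeClassesCorrCross_pushforward_act eXX eX'X' eX eX' eP eQ hnP hnQ hgXX hgX'X' hgX hgX' hGP hGQ hG hpp' hGC hq₁ hq₁' hqq hpp' hs hr hs' hr' hC hR,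
    integralHodgeClassesPushforward_sndHom_kunnethProjector_cup_pullbackHom_fstHom X eX eXX hX0 hgX hcX hgXX hq₁ hs hr s x,
    integralHodgeClassesPushforward_sndHom_kunnethProjector_cup_pullbackHom_fstHom X' eX' eX'X' hX'0 hgX' hcX' hgX'X' hq₁' hs' hr' t y]
  by_cases hx : 2 * p = s
  · by_cases hy : 2 * p' = t
    · rw [if_pos hx, if_pos hy, if_pos ⟨hx, hy⟩]
    · rw [if_neg hy, if_neg (show ¬(2 * p = s ∧ 2 * p' = t) from fun h ↦ hy h.2), map_zero]
  · rw [if_neg hx, if_neg (show ¬(2 * p = s ∧ 2 * p' = t) from fun h ↦ hx h.1), map_zero, AddMonoidHom.zero_apply]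

/-! ### §2 `(π_{s,X} × π_{t,X′})^*(u ⊠ v) = δ_{s+2p,2g_X} δ_{t+2p′,2g_{X′}} · (u ⊠ v)` -/

include eX eX' hnP hnQ hgX hgXX hgX' hgX'X' hq₁ hq₁' hqq hs hr hs' hr' in
/-- **`(π_{s,X} × π_{t,X′})^*(u ⊠ v) = δ_{s+2p,2g_X} δ_{t+2p′,2g_{X′}} · (u ⊠ v)`** for `u ∈ Hdgᵖ(X, ℤ)`, `v ∈ Hdg^{p′}(X′, ℤ)`: the contravariant action `α^*(z) = p_{1*}(α · p₂^*
z)` of the `(s, t)`-piece keeps `u ⊠ v` exactly when `(deg u, deg v) = (2g_X − s, 2g_{X′} − t)` (`(α × β)^*(u ⊠ v) = α^*u ⊠ β^*v`, g29-#4; `π_s^*u = δ_{s+2p,2g} u`, g29-#5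
§4). [cite: Fulton1998, §16.1 Def. 16.1.2 (p0295 L13–L17) and Example 16.1.12 (p0301 L9)] [cite: VoisinHodgeI2002, §11.3.3 p. 287] -/
theorem integralHodgeClassesKunnethProjectorCross_pushforward_coact (s t : ℕ) (u : integralHodgeClasses X.toIsog.Φ p) (v : integralHodgeClasses X'.toIsog.Φ p') :
    integralHodgeClassesPushforward C Q (fstHom (prodObj X X') (prodObj X X')) eP eQ hC hGP hR hGQ
        (integralHodgeClassesCup (prodObj (prodObj X X') (prodObj X X')).toIsog.Φ hGC
          (integralHodgeClassesCup (prodObj (prodObj X X') (prodObj X X')).toIsog.Φ hG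
            (integralHodgeClassesPullbackHom
              (liftHom (fstHom (prodObj X X') (prodObj X X') ≫ fstHom X X') (sndHom (prodObj X X') (prodObj X X') ≫ fstHom X X')) gX
              (kunnethProjector X eX eXX hX0 hgX hcX hgXX s))
            (integralHodgeClassesPullbackHom
              (liftHom (fstHom (prodObj X X') (prodObj X X') ≫ sndHom X X') (sndHom (prodObj X X') (prodObj X X') ≫ sndHom X X')) gX'
              (kunnethProjector X' eX' eX'X' hX'0 hgX' hcX' hgX'X' t)))
          (integralHodgeClassesPullbackHom (sndHom (prodObj X X') (prodObj X X')) Q (integralHodgeClassesCross X X' hpp' u v))) =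
      if s + 2 * p = 2 * gX ∧ t + 2 * p' = 2 * gX' then integralHodgeClassesCross X X' hpp' u v else 0 := by
  rw [integralHodgeClassesCorrCross_pushforward_coact eXX eX'X' eX eX' eP eQ hnP hnQ hgXX hgX'X' hgX hgX' hGP hGQ hG hpp' hGC hq₁ hq₁' hqq hpp' hs hr hs' hr' hC hR,
    integralHodgeClassesPushforward_fstHom_kunnethProjector_cup_pullbackHom_sndHom X eX eXX hX0 hgX hcX hgXX hq₁ hs hr s u,
    integralHodgeClassesPushforward_fstHom_kunnethProjector_cup_pullbackHom_sndHom X' eX' eX'X' hX'0 hgX' hcX' hgX'X' hq₁' hs' hr' t v]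
  by_cases hu : s + 2 * p = 2 * gX
  · by_cases hv : t + 2 * p' = 2 * gX'
    · rw [if_pos hu, if_pos hv, if_pos ⟨hu, hv⟩]
    · rw [if_neg hv, if_neg (show ¬(s + 2 * p = 2 * gX ∧ t + 2 * p' = 2 * gX') from fun h ↦ hv h.2), map_zero]
  · rw [if_neg hu, if_neg (show ¬(s + 2 * p = 2 * gX ∧ t + 2 * p' = 2 * gX') from fun h ↦ hu h.1), map_zero, AddMonoidHom.zero_apply]

end Actions

end ComplexTorusCat

end Literature.AlgebraicGeometry.HodgeTheory
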